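import Summits.QuantumFields.YangMills.Theorems.SwapVirialDeficitSectorLaplaceMbDensitySoftCeil
import HarnessLib

/-!
# The joint/relative substitution of the tip letters and its Jacobian `|p|⁴`

Sub-problem `SwapVirialDeficit`, crux ⟨stmt-QuantumFields-24197⟩ `SwapGluedStiffness`, skeleton ➎, stub `stub_core_tip`, socket (hCore), brick (F3b)
of w3 g68's design (HOME memo `w3-g68-memo-hCore-24197.md` §2(i)).  At the tip the two transverse leader letters `u, v ∈ ℝ²` are traded for the
JOINT tilt `τ` and the RELATIVE tilt `ρ` over the base point `p = (x₀, y₀) ≠ 0`: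
`(u, v) = J_p(τ, ρ) := (x₀•τ − y₀•ρ, y₀•τ + x₀•ρ)`, so that `x₀v − y₀u = |p|²ρ` is the stiff combination of ✓`gnoDeficit_floor_yAxial` and
`|u|² + |v|² = |p|²(|τ|² + |ρ|²)` (✓`tip_jointRel_letters`).  `J_p = |p| • (softRot_{x₀/|p|, y₀/|p|} ∘ softRot_{1,0})` is `|p|` times a rotation, so
its Jacobian is `|p|⁴`:
* `softRot_one_zero` — `softRot_{1,0}(τ,ρ) = (τ, −ρ)`;
* `jointRel_eq_smul_softRot` — the factorisation, pointwise;
* `lintegral_comp_smul_plane2` — `∫⁻ f(r • q) = (r⁴)⁻¹·∫⁻ f` on `ℝ² × ℝ²` (`r > 0`);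
* ★ `lintegral_jointRel_substitution` — `∫⁻ f(J_p q) dq = (|p|⁴)⁻¹ ∫⁻ f`, and ★ `lintegral_eq_jointRel` — `∫⁻ f = |p|⁴ · ∫⁻ f ∘ J_p` (measurable `f ≥ 0`).

HONEST LABEL: change-of-variables bookkeeping only; (hCore), `stub_core_tip`, ⟨24197⟩, ⟨24194⟩ remain OPEN; nothing here proves the Yang–Mills mass gap.
-/

noncomputable section

open MeasureTheory Set Module
open scoped BigOperators ENNReal

namespace Summit.QuantumFields.YangMills.Theorems.SwapVirialDeficit.SectorLaplace

/-- `softRot_{1,0}(τ, ρ) = (τ, −ρ)`. [folklore] -/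
theorem softRot_one_zero (q : (Fin 2 → ℝ) × (Fin 2 → ℝ)) :
    ((1 : ℝ) • q.1 + (0 : ℝ) • q.2, (0 : ℝ) • q.1 - (1 : ℝ) • q.2) = (q.1, -q.2) := by
  refine Prod.ext ?_ ?_ <;> simp

/-- The factorisation `J_p = |p| • (softRot_{c,s} ∘ softRot_{1,0})`, `c = x₀/|p|`, `s = y₀/|p|`, pointwise. [folklore] -/
theorem jointRel_eq_smul_softRot {x₀ y₀ : ℝ} (hp : 0 < x₀ ^ 2 + y₀ ^ 2) (q : (Fin 2 → ℝ) × (Fin 2 → ℝ)) :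
    (x₀ • q.1 - y₀ • q.2, y₀ • q.1 + x₀ • q.2) =
      Real.sqrt (x₀ ^ 2 + y₀ ^ 2) •
        ((x₀ / Real.sqrt (x₀ ^ 2 + y₀ ^ 2)) • ((1 : ℝ) • q.1 + (0 : ℝ) • q.2) + (y₀ / Real.sqrt (x₀ ^ 2 + y₀ ^ 2)) • ((0 : ℝ) • q.1 - (1 : ℝ) • q.2),
          (y₀ / Real.sqrt (x₀ ^ 2 + y₀ ^ 2)) • ((1 : ℝ) • q.1 + (0 : ℝ) • q.2) - (x₀ / Real.sqrt (x₀ ^ 2 + y₀ ^ 2)) • ((0 : ℝ) • q.1 - (1 : ℝ) • q.2)) := by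
  have hr : 0 < Real.sqrt (x₀ ^ 2 + y₀ ^ 2) := Real.sqrt_pos.2 hp
  have hr0 : Real.sqrt (x₀ ^ 2 + y₀ ^ 2) ≠ 0 := hr.ne'
  refine Prod.ext (funext fun i => ?_) (funext fun i => ?_) <;>
    simp only [Prod.smul_mk, Pi.add_apply, Pi.sub_apply, Pi.smul_apply, smul_eq_mul] <;> field_simp <;> ring

/-- Scaling on `ℝ² × ℝ²`: `∫⁻ f(r • q) dq = (r⁴)⁻¹ · ∫⁻ f` for `0 < r` and measurable `f`. [folklore] -/
theorem lintegral_comp_smul_plane2 {r : ℝ} (hr : 0 < r) {f : (Fin 2 → ℝ) × (Fin 2 → ℝ) → ℝ≥0∞} (hf : Measurable f) :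
    ∫⁻ q : (Fin 2 → ℝ) × (Fin 2 → ℝ), f (r • q) = ENNReal.ofReal ((r ^ 4)⁻¹) * ∫⁻ q : (Fin 2 → ℝ) × (Fin 2 → ℝ), f q := by
  haveI : (volume : Measure ((Fin 2 → ℝ) × (Fin 2 → ℝ))).IsAddHaarMeasure := Measure.prod.instIsAddHaarMeasure _ _
  have hmap := Measure.map_addHaar_smul (volume : Measure ((Fin 2 → ℝ) × (Fin 2 → ℝ))) hr.ne'
  have hd : finrank ℝ ((Fin 2 → ℝ) × (Fin 2 → ℝ)) = 4 := by simp
  rw [hd, abs_of_nonneg (by positivity)] at hmap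
  rw [← lintegral_map hf (measurable_const_smul r), hmap, lintegral_smul_measure, smul_eq_mul]

/-- ★ **THE JOINT/RELATIVE SUBSTITUTION**: for `p = (x₀,y₀) ≠ 0` and measurable `f ≥ 0` on `ℝ² × ℝ²`,
`∫⁻ f(x₀•τ − y₀•ρ, y₀•τ + x₀•ρ) d(τ,ρ) = ((x₀²+y₀²)²)⁻¹ · ∫⁻ f`. [folklore] -/
theorem lintegral_jointRel_substitution {x₀ y₀ : ℝ} (hp : 0 < x₀ ^ 2 + y₀ ^ 2) {f : (Fin 2 → ℝ) × (Fin 2 → ℝ) → ℝ≥0∞} (hf : Measurable f) :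
    ∫⁻ q : (Fin 2 → ℝ) × (Fin 2 → ℝ), f (x₀ • q.1 - y₀ • q.2, y₀ • q.1 + x₀ • q.2) =
      ENNReal.ofReal (((x₀ ^ 2 + y₀ ^ 2) ^ 2)⁻¹) * ∫⁻ q : (Fin 2 → ℝ) × (Fin 2 → ℝ), f q := by
  set r : ℝ := Real.sqrt (x₀ ^ 2 + y₀ ^ 2) with hrdef
  have hr : 0 < r := Real.sqrt_pos.2 hp
  have hcs : (x₀ / r) ^ 2 + (y₀ / r) ^ 2 = 1 := by
    have hr2 : r ^ 2 = x₀ ^ 2 + y₀ ^ 2 := by rw [hrdef]; exact Real.sq_sqrt hp.le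
    field_simp
    linarith
  have h10 : (1 : ℝ) ^ 2 + (0 : ℝ) ^ 2 = 1 := by norm_num
  have hO := (measurePreserving_softRot hcs).comp (measurePreserving_softRot h10)
  have hg : Measurable fun q : (Fin 2 → ℝ) × (Fin 2 → ℝ) => f (r • q) := hf.comp (measurable_const_smul r)
  have hcomp := hO.lintegral_comp hg
  have e : (fun q : (Fin 2 → ℝ) × (Fin 2 → ℝ) => f (x₀ • q.1 - y₀ • q.2, y₀ • q.1 + x₀ • q.2)) =
      fun q => f (r • ((fun q : (Fin 2 → ℝ) × (Fin 2 → ℝ) => ((x₀ / r) • q.1 + (y₀ / r) • q.2, (y₀ / r) • q.1 - (x₀ / r) • q.2)) ∘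
        (fun q : (Fin 2 → ℝ) × (Fin 2 → ℝ) => ((1 : ℝ) • q.1 + (0 : ℝ) • q.2, (0 : ℝ) • q.1 - (1 : ℝ) • q.2))) q) := by
    funext q
    rw [jointRel_eq_smul_softRot hp q]
    rfl
  rw [e, hcomp, lintegral_comp_smul_plane2 hr hf]
  congr 2
  rw [hrdef, show (4 : ℕ) = 2 * 2 from rfl, pow_mul, Real.sq_sqrt hp.le]

/-- ★ **THE SAME, SOLVED FOR `∫⁻ f`**: `∫⁻ f = (x₀²+y₀²)² · ∫⁻ f(x₀•τ − y₀•ρ, y₀•τ + x₀•ρ) d(τ,ρ)`. [folklore] -/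
theorem lintegral_eq_jointRel {x₀ y₀ : ℝ} (hp : 0 < x₀ ^ 2 + y₀ ^ 2) {f : (Fin 2 → ℝ) × (Fin 2 → ℝ) → ℝ≥0∞} (hf : Measurable f) :
    ∫⁻ q : (Fin 2 → ℝ) × (Fin 2 → ℝ), f q =
      ENNReal.ofReal ((x₀ ^ 2 + y₀ ^ 2) ^ 2) * ∫⁻ q : (Fin 2 → ℝ) × (Fin 2 → ℝ), f (x₀ • q.1 - y₀ • q.2, y₀ • q.1 + x₀ • q.2) := by
  rw [lintegral_jointRel_substitution hp hf, ← mul_assoc, ← ENNReal.ofReal_mul (by positivity), mul_inv_cancel₀ (by positivity), ENNReal.ofReal_one,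
    one_mul]

end Summit.QuantumFields.YangMills.Theorems.SwapVirialDeficit.SectorLaplace

end
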